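import Summits.SmoothPoincare4.SmoothPoincare4.Theorems.CylinderEntropyCylinderRungTwoHamiltonMonotonicityFrame
import Literature.Geometry.Lorentzian.HypersurfaceHessianCodimTwo
import Literature.Geometry.Lorentzian.GreenIdentity
import HarnessLib

/-!
# Hamilton's monotonicity along a smooth cylinder flow, part 3: the Green identity
# `∫_Σ Δ_Σ(φ|_Σ) dμ = 0` on a closed cross-section of `N = S⁴ × ℝ`, in ambient terms

Part 3 of the proof of the registered stub `stub_hamiltonMonotonicity` of line `killing-flux` of the
crux `CylinderEntropy.CylinderRungTwo` (stmt-SmoothPoincare4-7631). For a Riemannian immersion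
`f : M⁴ → ℝ⁶` of a closed manifold with image in `N`, a smooth unit normal `ν` of `f` tangent to `N`
(so that `{ν, n}`, `n = (z', 0) ∘ f`, is an orthonormal normal frame of the codimension-two
submanifold `f(M) ⊂ ℝ⁶`) and `φ ∈ C²(ℝ⁶)`:

* `trace_hessian_comp_eq_laplacian_sub` — the tangential trace of the ambient Hessian is
  `tr_{f^*δ}(Hess φ ∘ (df × df)) = Δ_{ℝ⁶}φ - D²φ(n, n) - D²φ(ν, ν)` (orthonormal basis
  `{df bᵢ} ∪ {ν, n}` of `ℝ⁶`, part 2);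
* `integral_sliceLaplacian_eq_zero` — **`∫_M ([Δ_{ℝ⁶}φ - D²φ(n,n) - 4Dφ(n)] - [D²φ(ν,ν) - |ν'|²Dφ(n)]
  - H Dφ(ν)) ∘ f dμ_{f^*δ} = 0`**: the integrand is `Δ_{f^*δ}(φ ∘ f)` by the codimension-two
  restriction formula `Δ_{f^*δ}(φ∘f) = tr(Hess φ ∘ (df×df)) - Dφ(ν) H_ν - Dφ(n) H_n`
  (`Literature/Geometry/Lorentzian/HypersurfaceHessianCodimTwo.lean`, `dalembertian_comp_eq₂`) with
  `H_n = 4 - |ν'|²` (part 2, `meanCurvature_radial_eq`), and its integral over the closed manifold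
  vanishes by Green's identity (`integral_dalembertian_eq_zero`, `GreenIdentity.lean`). The first
  bracket is `Δ_N φ` and the second `Hess_N φ(ν, ν)` (`N ⊂ ℝ⁶` has second fundamental form
  `-|v'|² n`), so this is `∫_Σ (Δ_N φ - Hess_N φ(ν,ν) - H ∂_ν φ) = ∫_Σ Δ_Σ φ = 0`, the integration by
  parts in Hamilton's monotonicity formula (Comm. Anal. Geom. 1 (1993), §4) for hypersurfaces of `N`;
* `stub_hamiltonMonotonicity_part3` — the registered sub-goal marker.

Everything is PROVED (no `sorry`, no new definitions, no named facts).

References: R. S. Hamilton, Comm. Anal. Geom. 1 (1993) 127–137, §4; B. O'Neill, *Semi-Riemannian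
Geometry* (1983), Ch. 4; J. M. Lee, *Introduction to Riemannian Manifolds* (2018), Problem 2-23.
-/

-- the prescribed namespace `Summit.SmoothPoincare4.SmoothPoincare4.…` repeats `SmoothPoincare4`
set_option linter.dupNamespace false

noncomputable section

open Bundle Set Function Filter MeasureTheory Module
open scoped Manifold ContDiff Topology RealInnerProductSpace BigOperators

namespace Summit.SmoothPoincare4.SmoothPoincare4.Cruxes.CylinderRungTwo.KillingFlux

open Literature.Geometry.Riemannian Literature.Geometry.Riemannian.EuclideanHypersurface
open Literature.Geometry.Lorentzian Literature.Geometry.Lorentzian.PseudoRiemannianMetric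
open Literature.Geometry.Riemannian.SphericalCylinderEntropy (truncL truncL_apply)
open Literature.Geometry.Manifold.CylinderSlice (padL padL_apply_castSucc padL_apply_last)

section SliceGeometry

variable {M : Type*} [TopologicalSpace M] [ChartedSpace (EuclideanSpace ℝ (Fin 4)) M]
  [IsManifold (𝓡 4) ∞ M]

/-- **The tangential trace of the ambient Hessian on a cross-section of `N`**: for a Riemannian
immersion `f : M⁴ → ℝ⁶` with image in `N`, unit normal `ν` tangent to `N`, radial normal
`n = (z', 0) ∘ f` and `φ` of class `C²` at `f w`,
`tr_{f^*δ}(Hess_δ φ ∘ (df × df))(w) = Σⱼ D²φ(eⱼ⁰, eⱼ⁰) - D²φ(n, n) - D²φ(ν, ν)` at `f w`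
(`{df bᵢ} ∪ {ν, n}` is an orthonormal basis of `ℝ⁶` for an `f^*δ`-orthonormal frame `b`;
`hessian_euclideanMetric_eq_fderiv_fderiv`, `sum_frame_add_eq_sum_single`). [cite: Hamilton1993, §4] -/
theorem trace_hessian_comp_eq_laplacian_sub {f νf : M → EuclideanSpace ℝ (Fin 6)}
    (hf : (euclideanMetric (EuclideanSpace ℝ (Fin 6))).IsSpacelikeImmersion (𝓡 4) f)
    (hun : (euclideanMetric (EuclideanSpace ℝ (Fin 6))).IsUnitNormal (𝓡 4) f νf 1)
    (hN : ∀ x, ∑ i : Fin 5, f x (Fin.castSucc i) ^ 2 = 1)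
    (hνN : ∀ x, ∑ i : Fin 5, νf x (Fin.castSucc i) * f x (Fin.castSucc i) = 0)
    {φ : EuclideanSpace ℝ (Fin 6) → ℝ} (w : M) (hφ : ContDiffAt ℝ 2 φ (f w)) :
    ((euclideanMetric (EuclideanSpace ℝ (Fin 6))).inducedMetric f contMDiff_pullbackBilin_holds hf).trace w
      (((euclideanMetric (EuclideanSpace ℝ (Fin 6))).hessian φ (f w)).comp
        (mfderiv (𝓡 4) 𝓘(ℝ, EuclideanSpace ℝ (Fin 6)) f w).toLinearMap
        (mfderiv (𝓡 4) 𝓘(ℝ, EuclideanSpace ℝ (Fin 6)) f w).toLinearMap) =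
      (∑ j : Fin 6, iteratedFDeriv ℝ 2 φ (f w)
          ![EuclideanSpace.single j (1 : ℝ), EuclideanSpace.single j (1 : ℝ)])
        - iteratedFDeriv ℝ 2 φ (f w) ![padL (truncL (f w)), padL (truncL (f w))]
        - iteratedFDeriv ℝ 2 φ (f w) ![νf w, νf w] := by
  set g₁ := (euclideanMetric (EuclideanSpace ℝ (Fin 6))).inducedMetric f
    contMDiff_pullbackBilin_holds hf with hg₁
  have hfs : ContMDiff (𝓡 4) 𝓘(ℝ, EuclideanSpace ℝ (Fin 6)) ∞ f := hf.contMDiff_self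
  have hrad := isUnitNormal_radial hfs hN
  have hpos : ∀ u : TangentSpace (𝓡 4) w, u ≠ 0 → 0 < g₁.val w u u :=
    fun u hu => isRiemannian_inducedMetric _ _ contMDiff_pullbackBilin_holds hf w u hu
  haveI : FiniteDimensional ℝ (TangentSpace (𝓡 4) w) :=
    inferInstanceAs (FiniteDimensional ℝ (EuclideanSpace ℝ (Fin 4)))
  obtain ⟨b, hb⟩ := g₁.exists_basis_isOrthonormalFrame hpos (m := 4)
    (by exact finrank_euclideanSpace_fin)
  set e : Fin 4 → EuclideanSpace ℝ (Fin 6) := fun i => (show EuclideanSpace ℝ (Fin 6) from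
    (mfderiv (𝓡 4) 𝓘(ℝ, EuclideanSpace ℝ (Fin 6)) f w :
      TangentSpace (𝓡 4) w →L[ℝ] EuclideanSpace ℝ (Fin 6)) (b i)) with he
  have hon : Orthonormal ℝ e := orthonormal_mfderiv_frame' hf w hb
  rw [g₁.trace_eq_sum_of_isOrthonormalFrame b hb]
  have hterm : ∀ i, (((euclideanMetric (EuclideanSpace ℝ (Fin 6))).hessian φ (f w)).comp
      (mfderiv (𝓡 4) 𝓘(ℝ, EuclideanSpace ℝ (Fin 6)) f w).toLinearMap
      (mfderiv (𝓡 4) 𝓘(ℝ, EuclideanSpace ℝ (Fin 6)) f w).toLinearMap) (b i) (b i) =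
      fderiv ℝ (fderiv ℝ φ) (f w) (e i) (e i) := by
    intro i
    rw [LinearMap.BilinForm.comp_apply]
    exact hessian_euclideanMetric_eq_fderiv_fderiv hφ (e i) (e i)
  rw [Finset.sum_congr rfl fun i _ => hterm i]
  have hνunit : ‖νf w‖ = 1 := by
    have h : ⟪νf w, νf w⟫ = (1 : ℝ) := by
      have := hun.val_self w
      rwa [euclideanMetric_apply] at this
    rw [real_inner_self_eq_norm_sq] at h
    nlinarith [norm_nonneg (νf w)]
  have hnunit : ‖padL (truncL (f w))‖ = 1 := by
    have h : ⟪padL (truncL (f w)), padL (truncL (f w))⟫ = (1 : ℝ) := by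
      have := hrad.val_self w
      rwa [euclideanMetric_apply] at this
    rw [real_inner_self_eq_norm_sq] at h
    nlinarith [norm_nonneg (padL (truncL (f w)))]
  have hνe : ∀ i, ⟪νf w, e i⟫ = 0 := fun i => by
    have := hun.isNormalTo w (b i)
    rwa [euclideanMetric_apply] at this
  have hne : ∀ i, ⟪padL (truncL (f w)), e i⟫ = 0 := fun i => by
    have := hrad.isNormalTo w (b i)
    rwa [euclideanMetric_apply] at this
  have hνn : ⟪νf w, padL (truncL (f w))⟫ = 0 := by
    rw [real_inner_comm, inner_padL_truncL_left]
    simpa only [mul_comm] using hνN w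
  have key := sum_frame_add_eq_sum_single hon hνunit hnunit hνe hne hνn
    (fderiv ℝ (fderiv ℝ φ) (f w))
  simp only [iteratedFDeriv_two_apply, Matrix.cons_val_zero, Matrix.cons_val_one]
  linarith

end SliceGeometry

section Divergence

variable {M : Type*} [TopologicalSpace M] [ChartedSpace (EuclideanSpace ℝ (Fin 4)) M]
  [IsManifold (𝓡 4) ∞ M] [CompactSpace M] [T2Space M] [MeasurableSpace M] [BorelSpace M]

/-- Mathlib's vector-valued manifold derivative `mvfderiv` on a vector space is `fderiv`. [folklore] -/
theorem mvfderiv_vectorSpace_apply {V F : Type*} [NormedAddCommGroup V] [NormedSpace ℝ V]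
    [NormedAddCommGroup F] [NormedSpace ℝ F] (φ : V → F) (x v : V) :
    mvfderiv 𝓘(ℝ, V) φ x v = fderiv ℝ φ x v := by
  simp only [mvfderiv, mfderiv_eq_fderiv]
  rfl

/-- **`∫_Σ Δ_Σ(φ|_Σ) dμ = 0` on a closed cross-section of `N`, in ambient terms.** For
`f : M → ℝ⁶` a Riemannian immersion of a closed `4`-manifold with image in `N = S⁴ × ℝ`, `ν` a
smooth unit normal of `f` tangent to `N`, and `φ ∈ C²(ℝ⁶)`,
`∫_M ([Δ_{ℝ⁶}φ - D²φ(n,n) - 4 Dφ(n)] - [D²φ(ν,ν) - |ν'|² Dφ(n)] - H Dφ(ν)) ∘ f dμ_{f^*δ} = 0`,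
`n = (z', 0)` the radial normal of `N`, `H` the mean curvature of `(f, ν)`: the integrand is
`Δ_{f^*δ}(φ ∘ f)` (`dalembertian_comp_eq₂` with the normals `ν, n`; the tangential trace of
`Hess φ` is `Δ_{ℝ⁶}φ - D²φ(n,n) - D²φ(ν,ν)` and the radial mean curvature is `4 - |ν'|²`), whose
integral vanishes by Green's identity (`integral_dalembertian_eq_zero`). [cite: Hamilton1993, §4] -/
theorem integral_sliceLaplacian_eq_zero {f νf : M → EuclideanSpace ℝ (Fin 6)}
    (hf : (euclideanMetric (EuclideanSpace ℝ (Fin 6))).IsSpacelikeImmersion (𝓡 4) f)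
    (hν : ContMDiff (𝓡 4) 𝓘(ℝ, EuclideanSpace ℝ (Fin 6)) ∞ νf)
    (hun : (euclideanMetric (EuclideanSpace ℝ (Fin 6))).IsUnitNormal (𝓡 4) f νf 1)
    (hN : ∀ x, ∑ i : Fin 5, f x (Fin.castSucc i) ^ 2 = 1)
    (hνN : ∀ x, ∑ i : Fin 5, νf x (Fin.castSucc i) * f x (Fin.castSucc i) = 0)
    {φ : EuclideanSpace ℝ (Fin 6) → ℝ} (hφ : ContDiff ℝ 2 φ) :
    ∫ w, (((∑ j : Fin 6, iteratedFDeriv ℝ 2 φ (f w)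
              ![EuclideanSpace.single j (1 : ℝ), EuclideanSpace.single j (1 : ℝ)])
            - iteratedFDeriv ℝ 2 φ (f w) ![padL (truncL (f w)), padL (truncL (f w))]
            - 4 * fderiv ℝ φ (f w) (padL (truncL (f w))))
          - (iteratedFDeriv ℝ 2 φ (f w) ![νf w, νf w]
            - (∑ i : Fin 5, νf w (Fin.castSucc i) ^ 2) * fderiv ℝ φ (f w) (padL (truncL (f w))))
          - (euclideanMetric (EuclideanSpace ℝ (Fin 6))).meanCurvature f contMDiff_pullbackBilin_holds
              hf νf w * fderiv ℝ φ (f w) (νf w))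
      ∂riemannianMeasure ((euclideanMetric (EuclideanSpace ℝ (Fin 6))).inducedRiemannianMetric f
        contMDiff_pullbackBilin_holds hf) = 0 := by
  set g := euclideanMetric (EuclideanSpace ℝ (Fin 6)) with hgdef
  haveI : (ofRiemannian (g.inducedRiemannianMetric f contMDiff_pullbackBilin_holds hf)).HasLeviCivita :=
    (g.inducedMetric f contMDiff_pullbackBilin_holds hf).hasLeviCivita
  haveI := (g.inducedMetric f contMDiff_pullbackBilin_holds hf).hasLeviCivita
  have hfs : ContMDiff (𝓡 4) 𝓘(ℝ, EuclideanSpace ℝ (Fin 6)) ∞ f := hf.contMDiff_self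
  have hrad := isUnitNormal_radial hfs hN
  have hns : ContMDiff (𝓡 4) 𝓘(ℝ, EuclideanSpace ℝ (Fin 6)) ∞ (fun y => padL (truncL (f y))) :=
    (padL.comp truncL).contDiff.comp_contMDiff hfs
  have hν₁ := contMDiff_lift_of_contMDiff hfs hν
  have hν₂ := contMDiff_lift_of_contMDiff hfs hns
  have h12 : ∀ y, g.val (f y) (νf y) (padL (truncL (f y))) = 0 := fun y => by
    rw [hgdef, euclideanMetric_apply]
    show ⟪νf y, padL (truncL (f y))⟫ = 0
    rw [real_inner_comm, inner_padL_truncL_left]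
    simpa only [mul_comm] using hνN y
  have hdim : finrank ℝ (EuclideanSpace ℝ (Fin 6)) = finrank ℝ (EuclideanSpace ℝ (Fin 4)) + 2 := by
    rw [finrank_euclideanSpace_fin, finrank_euclideanSpace_fin]
  have hφm : CMDiff 2 φ := hφ.contMDiff
  have hpt := fun w => PseudoRiemannianMetric.dalembertian_comp_eq₂ g contMDiff_pullbackBilin_holds hf
    hν₁ hν₂ hun hrad one_ne_zero one_ne_zero h12 hdim hφm w
  have hcomp : ContMDiff (𝓡 4) 𝓘(ℝ, ℝ) 2 (fun y => φ (f y)) :=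
    hφm.comp (hf.contMDiff.of_le (by norm_cast))
  have h0 : ∫ w, (g.inducedMetric f contMDiff_pullbackBilin_holds hf).dalembertian (fun y => φ (f y)) w
      ∂riemannianMeasure (g.inducedRiemannianMetric f contMDiff_pullbackBilin_holds hf) = 0 :=
    integral_dalembertian_eq_zero (h := g.inducedRiemannianMetric f contMDiff_pullbackBilin_holds hf) hcomp
  rw [← h0]
  refine integral_congr_ae (Eventually.of_forall fun w => ?_)
  rw [hpt w, div_one, div_one, trace_hessian_comp_eq_laplacian_sub hf hun hN hνN w hφ.contDiffAt,
    meanCurvature_radial_eq hf hun hN hνN w, mvfderiv_vectorSpace_apply, mvfderiv_vectorSpace_apply]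
  ring

end Divergence

/-- **Registered sub-goal marker `stub_hamiltonMonotonicity_part3` (`∫_Σ Δ_Σ(φ|_Σ) dμ = 0` on a
closed cross-section of `N`, in ambient terms).** For a Riemannian immersion `f : M⁴ → ℝ⁶` of a
closed manifold with image in `N = S⁴ × ℝ`, a smooth unit normal `ν` tangent to `N` and
`φ ∈ C²(ℝ⁶)`: `∫_M ([Δ_{ℝ⁶}φ - D²φ(n,n) - 4Dφ(n)] - [D²φ(ν,ν) - |ν'|²Dφ(n)] - H Dφ(ν)) ∘ f dμ_{f^*δ} = 0`
(`integral_sliceLaplacian_eq_zero`). [cite: Hamilton1993, §4] -/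
theorem stub_hamiltonMonotonicity_part3 :
    ∀ (M : Type) [TopologicalSpace M] [ChartedSpace (EuclideanSpace ℝ (Fin 4)) M] [IsManifold (𝓡 4) ∞ M] [CompactSpace M] [T2Space M] [MeasurableSpace M] [BorelSpace M] (f νf : M → EuclideanSpace ℝ (Fin 6)) (hf : (Literature.Geometry.Riemannian.euclideanMetric (EuclideanSpace ℝ (Fin 6))).IsSpacelikeImmersion (𝓡 4) f), ContMDiff (𝓡 4) (𝓡 6) ∞ νf → (Literature.Geometry.Riemannian.euclideanMetric (EuclideanSpace ℝ (Fin 6))).IsUnitNormal (𝓡 4) f νf 1 → (∀ x, ∑ i : Fin 5, f x (Fin.castSucc i) ^ 2 = 1) → (∀ x, ∑ i : Fin 5, νf x (Fin.castSucc i) * f x (Fin.castSucc i) = 0) → ∀ (φ : EuclideanSpace ℝ (Fin 6) → ℝ), ContDiff ℝ 2 φ → ∫ w, (((∑ j : Fin 6, iteratedFDeriv ℝ 2 φ (f w) ![EuclideanSpace.single j (1 : ℝ), EuclideanSpace.single j (1 : ℝ)]) - iteratedFDeriv ℝ 2 φ (f w) ![Literature.Geometry.Manifold.CylinderSlice.padL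 (Literature.Geometry.Riemannian.SphericalCylinderEntropy.truncL (f w)), Literature.Geometry.Manifold.CylinderSlice.padL (Literature.Geometry.Riemannian.SphericalCylinderEntropy.truncL (f w))] - 4 * fderiv ℝ φ (f w) (Literature.Geometry.Manifold.CylinderSlice.padL (Literature.Geometry.Riemannian.SphericalCylinderEntropy.truncL (f w)))) - (iteratedFDeriv ℝ 2 φ (f w) ![νf w, νf w] - (∑ i : Fin 5, νf w (Fin.castSucc i) ^ 2) * fderiv ℝ φ (f w) (Literature.Geometry.Manifold.CylinderSlice.padL (Literature.Geometry.Riemannian.SphericalCylinderEntropy.truncL (f w)))) - (Literature.Geometry.Riemannian.euclideanMetric (EuclideanSpace ℝ (Fin 6))).meanCurvature f Literature.Geometry.Lorentzian.PseudoRiemannianMetric.contMDiff_pullbackBilin_holds hf νf w * fderiv ℝ φ (f w) (νf w)) ∂Literature.Geometry.Lorentzian.riemannianMeasure ((Literature.Geometry.Riemannian.euclideanMetric (EuclideanSpace ℝ (Fin 6))).inducedRiemannianMetric f Literature.Geometry.Lorentzian.PseudoRiemannianMetric.contMDiff_pullbackBilin_holds hf) = 0 :=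
  fun _ _ _ _ _ _ _ _ _ _ hf hν hun hN hνN _ hφ => integral_sliceLaplacian_eq_zero hf hν hun hN hνN hφ

end Summit.SmoothPoincare4.SmoothPoincare4.Cruxes.CylinderRungTwo.KillingFlux

end
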